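import Literature.MathematicalPhysics.QuantumFieldTheory.Balaban1983to89.B5Hk163TorusHolderRate
import Literature.MathematicalPhysics.QuantumFieldTheory.Balaban1983to89.B5Hk160Torus
import HarnessLib

/-!
# NE7TorusCombPoints — the comb of axis-parallel paths on a discrete torus `Tor M = Π_μ ℤ∕M_μ` relative to centred coordinates, and
# the holonomy of a coordinate cycle with its discrete-Stokes step

Cell `pub-balaban`, rung (B)+1 sub-cell t4, lineage `b2b-balaban-t4-ne7-p1`, generation 65 (CRUX PROVER NE7 #1); hunt (h8) «REGULARITY ROAD»,
step (h8-ii) LIN-ONE-STEP, file B2a of A ∕ B1 ∕ B2a ∕ B2b ∕ C (memo `t4/b2b-balaban-t4-ne7-p1-g64/HUNT-H8-REGULARITY-ROAD.md` §4).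

WHY.  The cone (comb) gauge Poincaré lemma of file B2b (`NE7TorusConeGaugePoincare`) — the abelian torus image of the generalized axial
gauge with linear growth of [Balaban1985Variational] Sect. F (145) — integrates a 1-form `B` along the comb
`y₀ → (s_0) → (s_0,s_1) → … → y` of centred coordinates `s(y)` (file B1, `NE7TorusCombGaugeKit.exists_centredCoords`).  THIS FILE is the
geometry of that comb, with every object a hypothesis-carrying variable (no definition is introduced):
* §1 the COMB POINTS `Q_i(y,t) = y₀ + (s(y)_0, …, s(y)_{i−1}, t, 0, …, 0)`: shift ∕ step ∕ period in the running coordinate, the hand-over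
  `Q_i(y, s(y)_i) = Q_{i+1}(y, 0)`, `Q_{d+1}(y,·) = y`, `Q_0(y,0) = y₀`, and the response to a unit step `y ↦ y + e_ν`: axes `i ≤ ν` do not
  move (`Q_left`), axes `i > ν` are translated by `e_ν` (`Q_right` — the wrap `−M_ν` of the centred coordinate is invisible on the torus);
* §2 the HOLONOMY `G_ν(p) = Σ_{t<M_ν} B(p + t·e_ν, ν)` of the `ν`-cycle through `p` and its discrete-Stokes step
  `G_ν(p + e_j) − G_ν(p) = Σ_{t<M_ν} F_{jν}(B)(p + t·e_ν)` (`G_step`), hence `|G_ν(p + e_j) − G_ν(p)| ≤ M_ν·sup|F|`.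
HONEST FRAMING (page 1): [folklore] lattice calculus; 0 def, 0 sorry; nothing of Bałaban's asserted; NOT ONE-STEP, NOT NE7; spine 0∕9; finite T⁴
rung (B)+1 — NOT infinite volume, NOT mass gap, NOT Clay.  Continuum YM on T⁴ ⇐ BetaPertH ∧ nine spine estimates (0/9 proved); BetaPertH ⇐ (D1)
∧ (D4) ∧ CAP+tail; G-an2-4 gates asym, D1 and NE2/3/4.
-/

set_option autoImplicit false

noncomputable section

open Finset Matrix

namespace Summit.QuantumFields.BalabanUV.T4Continuum.NE7TorusCombPoints

open Literature.MathematicalPhysics.QuantumFieldTheory.Balaban1983to89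
open B5Prop11Plancherel (Tor unitVec)
open B5Action121 (Fs Fs_apply)
open B6LowerBound2153Torus (toT)

variable {d : ℕ} (M : Fin (d + 1) → ℕ) [hM : ∀ μ, NeZero (M μ)]

/-! ## §1. The comb points `Q_i(y,t)` -/

section Comb

variable (y₀ : Tor M) (s : Tor M → (Fin (d + 1) → ℤ))
  (hs1 : ∀ y, y₀ + toT M (s y) = y) (hs0 : s y₀ = 0)
  (hs2 : ∀ y (ν i : Fin (d + 1)), i ≠ ν → s (y + unitVec M ν) i = s y i)
  (Q : ℕ → Tor M → ℤ → Tor M)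
  (hQ : ∀ i y t, Q i y t = y₀ + toT M (fun j => if (j : ℕ) < i then s y j else if (j : ℕ) = i then t else 0))

include hQ

omit hM in
/-- moving the running coordinate: `Q_i(y,t) = Q_i(y,0) + t·e_i`. [folklore] -/
theorem Q_shift (i : Fin (d + 1)) (y : Tor M) (t : ℤ) : Q i y t = Q i y 0 + t • unitVec M i := by
  rw [hQ, hQ, add_assoc]
  congr 1
  ext j
  by_cases hj : j = i
  · subst hj; simp [toT, unitVec]
  · have hj' : (j : ℕ) ≠ i := fun h => hj (Fin.ext h)
    simp [toT, unitVec, hj, hj']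

omit hM in
/-- one step of the running coordinate: `Q_i(y,t+1) = Q_i(y,t) + e_i`. [folklore] -/
theorem Q_step (i : Fin (d + 1)) (y : Tor M) (t : ℤ) : Q i y (t + 1) = Q i y t + unitVec M i := by
  rw [Q_shift M y₀ s Q hQ i y (t + 1), Q_shift M y₀ s Q hQ i y t, add_zsmul, one_zsmul, add_assoc]

omit hM in
/-- the running coordinate is `M_i`-periodic on the torus. [folklore] -/
theorem Q_period (i : Fin (d + 1)) (y : Tor M) (t : ℤ) : Q i y (t + M i) = Q i y t := by
  rw [Q_shift M y₀ s Q hQ i y (t + M i), Q_shift M y₀ s Q hQ i y t, add_zsmul]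
  have h0 : ((M i : ℕ) : ℤ) • unitVec M i = 0 := by
    ext j
    by_cases hj : j = i
    · subst hj; simp [unitVec]
    · simp [unitVec, hj]
  rw [h0, add_zero]

omit hM in
/-- end of axis `i` = start of axis `i+1`: `Q_i(y, s(y)_i) = Q_{i+1}(y, 0)`. [folklore] -/
theorem Q_next (i : Fin (d + 1)) (y : Tor M) : Q i y (s y i) = Q ((i : ℕ) + 1) y 0 := by
  rw [hQ, hQ]
  congr 1
  ext j
  simp only [toT]
  congr 1
  by_cases h1 : (j : ℕ) < i
  · rw [if_pos h1, if_pos (by omega)]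
  · by_cases h2 : (j : ℕ) = i
    · rw [if_neg h1, if_pos h2, if_pos (by omega), show j = i from Fin.ext h2]
    · rw [if_neg h1, if_neg h2, if_neg (by omega), ite_self]

omit hM in
include hs1 in
/-- after the last axis the comb reaches `y`: `Q_{d+1}(y, t) = y`. [folklore] -/
theorem Q_top (y : Tor M) (t : ℤ) : Q (d + 1) y t = y := by
  calc Q (d + 1) y t = y₀ + toT M (s y) := by
        rw [hQ]
        congr 1
        ext j
        simp only [toT]
        rw [if_pos j.isLt]
    _ = y := hs1 y

omit hM in
/-- the comb starts at `y₀`: `Q_0(y, 0) = y₀`. [folklore] -/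
theorem Q_base (y : Tor M) : Q 0 y 0 = y₀ := by
  rw [hQ]
  conv_rhs => rw [← add_zero y₀]
  congr 1
  ext j
  simp [toT]

omit hM in
include hs2 in
/-- axes up to `ν` do not see a step in direction `ν`: `Q_i(y + e_ν, t) = Q_i(y, t)` for `i ≤ ν`. [folklore] -/
theorem Q_left {i : ℕ} {ν : Fin (d + 1)} (hi : i ≤ ν) (y : Tor M) (t : ℤ) : Q i (y + unitVec M ν) t = Q i y t := by
  rw [hQ, hQ]
  congr 1
  ext j
  simp only [toT]
  congr 1
  by_cases h1 : (j : ℕ) < i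
  · have hj : j ≠ ν := fun h => by subst h; omega
    rw [if_pos h1, if_pos h1, hs2 y ν j hj]
  · rw [if_neg h1, if_neg h1]

variable (hs3 : ∀ y (ν : Fin (d + 1)), s (y + unitVec M ν) ν = s y ν + 1 ∨
    (s (y + unitVec M ν) ν = s y ν + 1 - M ν ∧ (M ν : ℤ) ≤ 2 * s y ν + 1))

omit hM in
include hs2 hs3 in
/-- later axes are translated by the step: `Q_i(y + e_ν, t) = Q_i(y, t) + e_ν` for `ν < i` (the wrap `−M_ν` is invisible on the torus). [folklore] -/
theorem Q_right {i : ℕ} {ν : Fin (d + 1)} (hi : (ν : ℕ) < i) (y : Tor M) (t : ℤ) :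
    Q i (y + unitVec M ν) t = Q i y t + unitVec M ν := by
  rw [hQ, hQ, add_assoc]
  congr 1
  ext j
  by_cases hj : j = ν
  · subst hj
    have hu : unitVec M j j = 1 := by simp [unitVec]
    simp only [Pi.add_apply, toT, if_pos hi, hu]
    rcases hs3 y j with h | ⟨h, -⟩
    · rw [h]; push_cast; ring
    · rw [h]; push_cast; simp
  · have hj' : unitVec M ν j = 0 := by simp [unitVec, hj]
    simp only [Pi.add_apply, toT, hj', add_zero]
    congr 1
    by_cases h1 : (j : ℕ) < i
    · rw [if_pos h1, if_pos h1, hs2 y ν j hj]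
    · rw [if_neg h1, if_neg h1]

end Comb

/-! ## §2. The cycle holonomy `G_ν` and its walk -/

section Holonomy

variable (B : Tor M × Fin (d + 1) → ℂ) {f : ℝ} (hF : ∀ y (μ ν : Fin (d + 1)), ‖Fs M 1 B μ ν y‖ ≤ f)
  (G : Fin (d + 1) → Tor M → ℂ) (hG : ∀ ν p, G ν p = ∑ t ∈ Finset.range (M ν), B (p + (t : ℤ) • unitVec M ν, ν))

include hG in
/-- **discrete Stokes on a cylinder**: `G_ν(p + e_j) − G_ν(p) = Σ_{t<M_ν} F_{jν}(B)(p + t·e_ν)` (the `j`-components telescope around the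
closed `ν`-cycle). [folklore] -/
theorem G_step (ν j : Fin (d + 1)) (p : Tor M) :
    G ν (p + unitVec M j) - G ν p = ∑ t ∈ Finset.range (M ν), Fs M 1 B j ν (p + (t : ℤ) • unitVec M ν) := by
  rw [hG, hG, ← Finset.sum_sub_distrib]
  have htel : ∑ t ∈ Finset.range (M ν),
      (B (p + (((t + 1 : ℕ) : ℤ)) • unitVec M ν, j) - B (p + (t : ℤ) • unitVec M ν, j)) = 0 := by
    rw [Finset.sum_range_sub (fun t => B (p + (t : ℤ) • unitVec M ν, j))]
    have h0 : ((M ν : ℕ) : ℤ) • unitVec M ν = 0 := by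
      ext i
      by_cases hi : i = ν
      · subst hi; simp [unitVec]
      · simp [unitVec, hi]
    simp [h0]
  rw [← add_zero (∑ t ∈ Finset.range (M ν), Fs M 1 B j ν (p + (t : ℤ) • unitVec M ν)), ← htel, ← Finset.sum_add_distrib]
  refine Finset.sum_congr rfl fun t _ => ?_
  rw [Fs_apply]
  have e1 : p + unitVec M j + (t : ℤ) • unitVec M ν = p + (t : ℤ) • unitVec M ν + unitVec M j := by abel
  have e2 : p + (((t + 1 : ℕ) : ℤ)) • unitVec M ν = p + (t : ℤ) • unitVec M ν + unitVec M ν := by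
    push_cast; rw [add_zsmul, one_zsmul, add_assoc]
  rw [e1, e2]; ring

include hG hF in
/-- one step of the base point moves the holonomy by at most `M_ν·f`. [folklore] -/
theorem norm_G_step_le (ν j : Fin (d + 1)) (p : Tor M) : ‖G ν (p + unitVec M j) - G ν p‖ ≤ (M ν : ℝ) * f := by
  rw [G_step M B G hG]
  refine (norm_sum_le _ _).trans ?_
  calc ∑ t ∈ Finset.range (M ν), ‖Fs M 1 B j ν (p + (t : ℤ) • unitVec M ν)‖
      ≤ ∑ _t ∈ Finset.range (M ν), f := Finset.sum_le_sum fun t _ => hF _ _ _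
    _ = (M ν : ℝ) * f := by rw [Finset.sum_const, Finset.card_range, nsmul_eq_mul]

end Holonomy

end Summit.QuantumFields.BalabanUV.T4Continuum.NE7TorusCombPoints
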